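import Summits.CriticalPhenomena.PercolationContinuityZ3.Theorems.PercNearOneGluingNoHeavyQuantZeroOneK5Cert
import HarnessLib

/-!
# The far-relay row FAR (`Quant.FarRelayRow`) on few vertices by two-copy certificates: tables, soundness, closedness, easy cases

builds on p205010 (kernel theorem, internal audit signed; external expert review pending)

Support file (`--supports stmt-CriticalPhenomena-4575`), seat `prim-cert-1` (gen 9).  QUANT lane rung R8: `Quant.FarRelayRow` (OPEN) —
for every finite weighted graph, observer `o`, vertex set `A`, layer `j`: `2j < Σ_{a∈A} P(o ↔ a)` and `P(o ↮ a) ≤ t` (`a ∈ A`) imply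
`P(#{a ∈ A : o ↔ a} ≤ j) ≤ t`.  This file is the measure-side bookkeeping for proving ALL instances of FAR on at most five vertices
from exact two-copy (Bernstein bidegree-2) certificates (`TwoCopy.twoCopyCheck` of `…TwoCopyFibre`), generalising the layer-1 /
three-relay bookkeeping of `…QuantZeroOneK5Cert` (whose `open_of_generic` and relabelling helpers are reused) to any relay list and layer:

* TABLES `tF j i c = 1[o ↮ v_i](c) − 1[N(c) ≤ j]`, `hF j c = N(c) − 2j` and their expectations (`ex_leLayer`, `ex_tF`, `ex_hF`);
* `farLayer_le_of_check_open` — a passed check (tables agreeing with `tF, hF` below `2^m`) with a multiplier `a ≢ 0` gives, on the OPEN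
  weight cube, `Σ_v P(o ↔ v) ≥ 2j ∧ (∀ v, P(o ↮ v) ≤ t) ⟹ P(N ≤ j) ≤ t`;
* `FARp w A o j` — the FAR instance; transport along vertex permutations (`FARp.of_relabel`), closedness in the weights (`FARp.of_limit`,
  `FARp.of_generic`), and the EASY instances: `FARp.of_card_le` (`|A| ≤ 2j`: vacuous), `FARp.zero` (layer `0`), `FARp.one_of_mem`
  (layer `1`, `o ∈ A`).

No sorries; standard axioms; nothing computational; nothing asserts `FarRelayRow` itself.
[cite: KozmaNitzan2024, Lemma 2 (p. 6), Conjecture 3 (p. 15)] (context: the lower-tail family; FAR is this programme's statement).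
-/

namespace Summit.CriticalPhenomena.PercolationContinuityZ3.Theorems.TwoCopy

open Finset MeasureTheory Filter Topology
open Literature.Probability.Percolation Literature.Probability.LatticeModels
open Summit.CriticalPhenomena.PercolationContinuityZ3.Theorems.AdditiveGluing.Negative.Cert
open scoped Classical

/-! ## Tables of the FAR family -/

/-- Target table at layer `j`: `t_i(c) = 1[o ↮ v_i in c] − 1[N(c) ≤ j]`, `v_i = As[i]` (junk `o` beyond the list). [this work] -/
def tF (n : ℕ) (es : List (Fin n × Fin n)) (As : List (Fin n)) (o : Fin n) (j : ℕ) (i c : ℕ) : ℤ :=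
  (if connB n es c o (As.getD i o) then 0 else 1) - (if relayCount n es As o c ≤ j then 1 else 0)

/-- Hypothesis table at layer `j`: `h(c) = N(c) − 2j`. [this work] -/
def hF (n : ℕ) (es : List (Fin n × Fin n)) (As : List (Fin n)) (o : Fin n) (j : ℕ) (c : ℕ) : ℤ :=
  (relayCount n es As o c : ℤ) - 2 * j

section Expect

variable {n : ℕ} (w : Sym2 (Fin n) → unitInterval)

/-- `E_w[1[N ≤ j]] = P_w(N ≤ j)`. [this work] -/
theorem ex_leLayer {As : List (Fin n)} (hAs : As.Nodup) (o : Fin n) (j : ℕ) :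
    ex (mA n) (wA w) (fun c => if relayCount n (allPairs n) As o c ≤ j then 1 else 0) =
      (prodBernoulli w).real {ω : Set (Sym2 (Fin n)) | (As.toFinset.filter fun a => ω ∈ openConn o a).card ≤ j} := by
  classical
  set D : Set (Set (Sym2 (Fin n))) := {ω | (As.toFinset.filter fun a => ω ∈ openConn o a).card ≤ j} with hDdef
  have hdet : DeterminedBy D (↑(Eset (allPairs n)) : Set (Sym2 (Fin n))) :=
    determinedBy_allPairs_of_openGraph fun ω ω' h => by
      simp only [hDdef, Set.mem_setOf_eq, openConn, h]
  rw [prodBernoulli_real_eq_ex w (allPairs n) (nodup_map_mkE_allPairs n) D hdet]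
  refine sum_congr rfl fun c _ => ?_
  dsimp only
  congr 1
  rw [relayCount_eq_card _ hAs o c]
  simp only [hDdef, Set.mem_setOf_eq]

/-- `E_w[h] = Σ_{v ∈ R} P_w(o ↔ v) − 2j`. [this work] -/
theorem ex_hF {As : List (Fin n)} (hAs : As.Nodup) (o : Fin n) (j : ℕ) :
    ex (mA n) (wA w) (fun c => (hF n (allPairs n) As o j c : ℝ)) =
      (∑ a ∈ As.toFinset, (prodBernoulli w).real (openConn o a)) - 2 * j := by
  have h2 : ex (mA n) (wA w) (fun _ => (2 * j : ℝ)) = 2 * j := by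
    have := ex_const_mul (mA n) (wA w) (2 * j) (fun _ => 1)
    simp only [mul_one] at this
    rw [this, ex_one w (allPairs n) (nodup_map_mkE_allPairs n), mul_one]
  unfold hF
  push_cast
  rw [ex_sub, ex_relayCount w hAs o, h2]

/-- `E_w[t_i] = P_w(o ↮ v_i) − P_w(N ≤ j)`. [this work] -/
theorem ex_tF {As : List (Fin n)} (hAs : As.Nodup) (o : Fin n) (j i : ℕ) :
    ex (mA n) (wA w) (fun c => (tF n (allPairs n) As o j i c : ℝ)) =
      (prodBernoulli w).real (openConn o (As.getD i o))ᶜ -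
      (prodBernoulli w).real {ω : Set (Sym2 (Fin n)) | (As.toFinset.filter fun a => ω ∈ openConn o a).card ≤ j} := by
  unfold tF
  push_cast
  rw [ex_sub, ex_notConnB w, ex_leLayer w hAs o j]

end Expect

/-! ## FAR on the open cube from a passed check -/

/-- **A FAR instance on the OPEN cube from a two-copy certificate.**  If the check passes for tables `t', h'` agreeing with
`tF, hF` below `2^m` (relay list of length `K`, layer `j`) and a multiplier `a` with a positive entry, then for every weight
vector with all pair weights in `(0,1)`, `Σ_{v∈R} P(o ↔ v) ≥ 2j` and all cuts `P(o ↮ v) ≤ t`: `P(N ≤ j) ≤ t`. [this work] -/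
theorem farLayer_le_of_check_open {n : ℕ} {As : List (Fin n)} (hAs : As.Nodup) (o : Fin n) (j : ℕ) {K : ℕ} (hK : As.length = K)
    {t' : ℕ → ℕ → ℤ} {h' : ℕ → ℤ} {a : ℕ → ℕ → ℕ} {b : ℕ → ℕ}
    (ht' : ∀ i < K, ∀ c < 2 ^ mA n, t' i c = tF n (allPairs n) As o j i c)
    (hh' : ∀ c < 2 ^ mA n, h' c = hF n (allPairs n) As o j c)
    (hc : twoCopyCheck (mA n) K t' h' a b = true)
    {i₀ c₀ : ℕ} (hi₀ : i₀ < K) (hc₀ : c₀ < 2 ^ mA n) (ha₀ : 0 < a i₀ c₀)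
    (w : Sym2 (Fin n) → unitInterval) (hopen : ∀ i < mA n, 0 < wA w i ∧ wA w i < 1)
    (hEN : (2 * j : ℝ) ≤ ∑ x ∈ As.toFinset, (prodBernoulli w).real (openConn o x))
    (t : ℝ) (hcut : ∀ x ∈ As.toFinset, (prodBernoulli w).real (openConn o x)ᶜ ≤ t) :
    (prodBernoulli w).real {ω : Set (Sym2 (Fin n)) | (As.toFinset.filter fun x => ω ∈ openConn o x).card ≤ j} ≤ t := by
  classical
  set L := (prodBernoulli w).real {ω : Set (Sym2 (Fin n)) | (As.toFinset.filter fun x => ω ∈ openConn o x).card ≤ j} with hL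
  have hw01 : ∀ i, 0 ≤ wA w i ∧ wA w i ≤ 1 := fun i => wN_mem w (allPairs n) i
  have hexh : ex (mA n) (wA w) (fun c => (h' c : ℝ)) = ex (mA n) (wA w) (fun c => (hF n (allPairs n) As o j c : ℝ)) := by
    unfold ex
    exact sum_congr rfl fun c hc' => by dsimp only; rw [hh' c (mem_range.1 hc')]
  have hext : ∀ i < K, ex (mA n) (wA w) (fun c => (t' i c : ℝ)) = ex (mA n) (wA w) (fun c => (tF n (allPairs n) As o j i c : ℝ)) := by
    intro i hi
    unfold ex
    exact sum_congr rfl fun c hc' => by dsimp only; rw [ht' i hi c (mem_range.1 hc')]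
  have hh : 0 ≤ ex (mA n) (wA w) (fun c => (h' c : ℝ)) := by
    rw [hexh, ex_hF w hAs o j]; linarith
  have key := sum_ex_mul_ex_nonneg_of_check hc hw01 hh
  have hcut' : ∀ i ∈ range K, ex (mA n) (wA w) (fun c => (t' i c : ℝ)) ≤ t - L := by
    intro i hi
    rw [mem_range] at hi
    rw [hext i hi, ex_tF w hAs o j i]
    have hi' : i < As.length := by omega
    have e1 : As.getD i o = As[i] := by
      rw [List.getD_eq_getElem?_getD, List.getElem?_eq_getElem hi', Option.getD_some]
    have := hcut _ (List.mem_toFinset.2 (e1 ▸ List.getElem_mem hi'))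
    linarith
  have hapos : ∀ i, 0 ≤ ex (mA n) (wA w) (fun c => (a i c : ℝ)) := fun i => ex_nonneg _ hw01 fun c => Nat.cast_nonneg _
  have hΛ : 0 < ∑ i ∈ range K, ex (mA n) (wA w) (fun c => (a i c : ℝ)) := by
    refine lt_of_lt_of_le ?_ (single_le_sum (fun i _ => hapos i) (mem_range.2 hi₀))
    unfold ex
    refine lt_of_lt_of_le ?_ (single_le_sum (fun c _ => mul_nonneg (Nat.cast_nonneg _) (wt_nonneg _ hw01 c)) (mem_range.2 hc₀))
    exact mul_pos (by exact_mod_cast ha₀) (wt_pos_of_lt _ hopen c₀)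
  have hsum : ∑ i ∈ range K, ex (mA n) (wA w) (fun c => (t' i c : ℝ)) * ex (mA n) (wA w) (fun c => (a i c : ℝ)) ≤
      ∑ i ∈ range K, (t - L) * ex (mA n) (wA w) (fun c => (a i c : ℝ)) :=
    sum_le_sum fun i hi => mul_le_mul_of_nonneg_right (hcut' i hi) (hapos i)
  rw [← mul_sum] at hsum
  have h3 : 0 ≤ (t - L) * ∑ i ∈ range K, ex (mA n) (wA w) (fun c => (a i c : ℝ)) := le_trans key hsum
  by_contra hlt
  have h4 : (t - L) * ∑ i ∈ range K, ex (mA n) (wA w) (fun c => (a i c : ℝ)) < 0 :=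
    mul_neg_of_neg_of_pos (by linarith) hΛ
  linarith

/-! ## The FAR instance: relabelling, closedness, easy cases -/

/-- The FAR instance at `(w, A, o, j)`: `2j < Σ_{v∈A} P(o ↔ v) → (∀ v ∈ A, P(o ↮ v) ≤ t) → P(#{v ∈ A : o ↔ v} ≤ j) ≤ t`. [this work] -/
def FARp {n : ℕ} (w : Sym2 (Fin n) → unitInterval) (A : Finset (Fin n)) (o : Fin n) (j : ℕ) : Prop :=
  (2 * j : ℝ) < ∑ v ∈ A, (prodBernoulli w).real (openConn o v) →
    ∀ t : ℝ, (∀ v ∈ A, (prodBernoulli w).real (openConn o v)ᶜ ≤ t) →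
      (prodBernoulli w).real {ω : BondConfig (Fin n) | (A.filter fun v => ω ∈ openConn o v).card ≤ j} ≤ t

/-- **Relabelling**: `FARp` for `(w, A, o, j)` follows from `FARp` for `(w^σ, σ A, σ o, j)`. [this work] -/
theorem FARp.of_relabel {n : ℕ} (σ : Equiv.Perm (Fin n)) (w : Sym2 (Fin n) → unitInterval) (A : Finset (Fin n)) (o : Fin n)
    (j : ℕ) (h : FARp (relabelW σ w) (A.map σ.toEmbedding) (σ o) j) : FARp w A o j := by
  intro hEN t hcut
  have hcut' : ∀ v ∈ A.map σ.toEmbedding, (prodBernoulli (relabelW σ w)).real (openConn (σ o) v)ᶜ ≤ t := by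
    intro v hv
    obtain ⟨x, hx, rfl⟩ := Finset.mem_map.1 hv
    rw [Equiv.toEmbedding_apply, ← real_compl_openConn_relabelW σ w o x]
    exact hcut x hx
  have hmean := sum_openConn_relabelW σ w A o
  have key := h (by rw [hmean]; exact hEN) t hcut'
  have hev : BondConfig.relabel (sym2Equiv σ) ⁻¹' {ω : BondConfig (Fin n) |
        ((A.map σ.toEmbedding).filter fun v => ω ∈ openConn (σ o) v).card ≤ j} =
      {ω : BondConfig (Fin n) | (A.filter fun v => ω ∈ openConn o v).card ≤ j} := by
    ext ω
    simp only [Set.mem_preimage, Set.mem_setOf_eq, card_filter_relabel σ A o ω]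
  rw [← hev, real_preimage_relabelW]
  exact key

/-- The event `{N ≤ j}` is read off the open graph. [folklore] -/
theorem leLayer_of_openGraph {n : ℕ} (A : Finset (Fin n)) (o : Fin n) (j : ℕ) (ω ω' : Set (Sym2 (Fin n)))
    (h : openGraph ω = openGraph ω') :
    (ω ∈ {ω : BondConfig (Fin n) | (A.filter fun v => ω ∈ openConn o v).card ≤ j}) ↔
    (ω' ∈ {ω : BondConfig (Fin n) | (A.filter fun v => ω ∈ openConn o v).card ≤ j}) := by
  have : (A.filter fun v => ω ∈ openConn o v) = A.filter fun v => ω' ∈ openConn o v :=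
    Finset.filter_congr fun v _ => OneCutCert.openConn_of_openGraph o v ω ω' h
  simp only [Set.mem_setOf_eq, this]

/-- **Closedness**: if `FARp · A o j` holds along a sequence of weight vectors converging to `w`, it holds at `w`. [this work] -/
theorem FARp.of_limit {n : ℕ} (A : Finset (Fin n)) (o : Fin n) (j : ℕ) (w : Sym2 (Fin n) → unitInterval)
    (u : ℕ → Sym2 (Fin n) → unitInterval) (hu : Tendsto u atTop (𝓝 w)) (h : ∀ᶠ k in atTop, FARp (u k) A o j) :
    FARp w A o j := by
  intro hEN t hcut
  by_cases hne : A.Nonempty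
  · set D : (Sym2 (Fin n) → unitInterval) → ℝ := fun v =>
      A.sup' hne fun x => (prodBernoulli v).real (openConn o x)ᶜ with hD
    set L : (Sym2 (Fin n) → unitInterval) → ℝ := fun v => (prodBernoulli v).real {ω : BondConfig (Fin n) |
        (A.filter fun x => ω ∈ openConn o x).card ≤ j} with hL
    set E : (Sym2 (Fin n) → unitInterval) → ℝ := fun v => ∑ x ∈ A, (prodBernoulli v).real (openConn o x) with hE
    have hDc : Continuous D := Continuous.finset_sup'_apply hne fun x _ =>
      OneCutCert.continuous_real_of_openGraph _ fun ω ω' h => not_congr (OneCutCert.openConn_of_openGraph o x ω ω' h)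
    have hLc : Continuous L := OneCutCert.continuous_real_of_openGraph _ (leLayer_of_openGraph A o j)
    have hEc : Continuous E := continuous_finsetSum _ fun x _ =>
      OneCutCert.continuous_real_of_openGraph _ (OneCutCert.openConn_of_openGraph o x)
    have hev : ∀ᶠ k in atTop, L (u k) ≤ D (u k) := by
      have h2 : ∀ᶠ k in atTop, (2 * j : ℝ) < E (u k) :=
        (hEc.tendsto w).comp hu |>.eventually (lt_mem_nhds hEN)
      refine (h2.and h).mono fun k hk => ?_
      exact hk.2 hk.1 (D (u k)) fun x hx =>
        Finset.le_sup' (fun x : Fin n => (prodBernoulli (u k)).real (openConn o x)ᶜ) hx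
    have hlim : L w ≤ D w :=
      le_of_tendsto_of_tendsto ((hLc.tendsto w).comp hu) ((hDc.tendsto w).comp hu) hev
    exact hlim.trans (Finset.sup'_le hne _ fun x hx => hcut x hx)
  · exfalso
    rw [Finset.not_nonempty_iff_eq_empty] at hne
    rw [hne, Finset.sum_empty] at hEN
    have : (0 : ℝ) ≤ 2 * j := by positivity
    linarith

/-- **Generic weights suffice**: if `FARp · A o j` holds for every generic weight vector then it holds for all. [this work] -/
theorem FARp.of_generic {n : ℕ} (A : Finset (Fin n)) (o : Fin n) (j : ℕ)
    (h : ∀ w : Sym2 (Fin n) → unitInterval, OneCutCert.Generic w → FARp w A o j) (w : Sym2 (Fin n) → unitInterval) :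
    FARp w A o j := by
  refine FARp.of_limit A o j w (fun k e => OneCutCert.nudge k (w e))
    (tendsto_pi_nhds.2 fun e => OneCutCert.nudge_tendsto (w e)) ?_
  have hall : ∀ᶠ k in atTop, ∀ e : Sym2 (Fin n),
      ((OneCutCert.nudge k (w e) : ℝ) ≠ 0 ∧ (OneCutCert.nudge k (w e) : ℝ) ≠ 1 / 2 ∧ (OneCutCert.nudge k (w e) : ℝ) ≠ 1) :=
    Filter.eventually_all.2 fun e => OneCutCert.nudge_eventually_generic (w e)
  exact hall.mono fun k hk => h _ fun e _ => hk e

/-- Generic weights stay generic under relabelling. [this work] -/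
theorem generic_relabelW {n : ℕ} (σ : Equiv.Perm (Fin n)) (w : Sym2 (Fin n) → unitInterval) (hg : OneCutCert.Generic w) :
    OneCutCert.Generic (relabelW σ w) := by
  intro e he
  have hnd : ¬ ((sym2Equiv σ).symm e).IsDiag := by
    intro hd
    apply he
    induction e using Sym2.ind with
    | h x y =>
      have h1 : (sym2Equiv σ).symm s(x, y) = s(σ.symm x, σ.symm y) := rfl
      rw [h1, Sym2.mk_isDiag_iff] at hd
      rw [Sym2.mk_isDiag_iff]
      exact σ.symm.injective hd
  exact hg ((sym2Equiv σ).symm e) hnd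

/-- **Vacuous layers**: if `|A| ≤ 2j` the hypothesis `2j < Σ_{v∈A} P(o ↔ v)` cannot hold. [this work] -/
theorem FARp.of_card_le {n : ℕ} (w : Sym2 (Fin n) → unitInterval) (A : Finset (Fin n)) (o : Fin n) (j : ℕ)
    (hA : A.card ≤ 2 * j) : FARp w A o j := by
  intro hEN t _
  exfalso
  have : ∑ v ∈ A, (prodBernoulli w).real (openConn o v) ≤ A.card :=
    calc ∑ v ∈ A, (prodBernoulli w).real (openConn o v) ≤ ∑ _v ∈ A, (1 : ℝ) :=
          Finset.sum_le_sum fun v _ => measureReal_le_one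
      _ = A.card := by simp
  have hc : (A.card : ℝ) ≤ 2 * j := by exact_mod_cast hA
  linarith

/-- **Layer `0`**: `P(N = 0) ≤ P(o ↮ v)` for any `v ∈ A` (and `A ≠ ∅` since `Σ > 0`). [this work] -/
theorem FARp.zero {n : ℕ} (w : Sym2 (Fin n) → unitInterval) (A : Finset (Fin n)) (o : Fin n) : FARp w A o 0 := by
  intro hEN t hcut
  obtain ⟨v, hvA⟩ : A.Nonempty := by
    by_contra hne
    rw [Finset.not_nonempty_iff_eq_empty] at hne
    rw [hne, Finset.sum_empty] at hEN
    norm_num at hEN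
  have hsub : {ω : BondConfig (Fin n) | (A.filter fun v => ω ∈ openConn o v).card ≤ 0} ⊆
      (openConn o v : Set (BondConfig (Fin n)))ᶜ := by
    intro ω hω hωv
    have hvF : v ∈ A.filter fun u => ω ∈ openConn o u := Finset.mem_filter.2 ⟨hvA, hωv⟩
    have h1 : 0 < (A.filter fun u => ω ∈ openConn o u).card := Finset.card_pos.2 ⟨v, hvF⟩
    have h0 : (A.filter fun u => ω ∈ openConn o u).card ≤ 0 := hω
    omega
  exact (measureReal_mono hsub (measure_ne_top _ _)).trans (hcut v hvA)

/-- **Layer `1` with `o ∈ A`** (`|A| ≥ 2`): `o` reaches itself, so `{N ≤ 1} ⊆ {o ↮ v}` for any other `v ∈ A`. [this work] -/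
theorem FARp.one_of_mem {n : ℕ} (w : Sym2 (Fin n) → unitInterval) (A : Finset (Fin n)) (o : Fin n) (hoA : o ∈ A)
    (hA : 1 < A.card) : FARp w A o 1 := by
  intro _ t hcut
  obtain ⟨v, hvA, hvo⟩ := Finset.exists_mem_ne hA o
  have hsub : {ω : BondConfig (Fin n) | (A.filter fun v => ω ∈ openConn o v).card ≤ 1} ⊆
      (openConn o v : Set (BondConfig (Fin n)))ᶜ := by
    intro ω hω hωv
    have hoF : o ∈ A.filter fun u => ω ∈ openConn o u :=
      Finset.mem_filter.2 ⟨hoA, (SimpleGraph.Reachable.refl o : (openGraph ω).Reachable o o)⟩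
    have hvF : v ∈ A.filter fun u => ω ∈ openConn o u := Finset.mem_filter.2 ⟨hvA, hωv⟩
    have h2 : 1 < (A.filter fun u => ω ∈ openConn o u).card := Finset.one_lt_card.2 ⟨v, hvF, o, hoF, hvo⟩
    have h1 : (A.filter fun u => ω ∈ openConn o u).card ≤ 1 := hω
    omega
  exact (measureReal_mono hsub (measure_ne_top _ _)).trans (hcut v hvA)

/-! ## Certificate-instance helpers and canonical relay lists on `Fin 5` -/

/-- A table of naturals from sparse `(index, value)` pairs (zero elsewhere). [this work] -/
def sparseTable (N : ℕ) (l : List (ℕ × ℕ)) : Array ℕ :=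
  l.foldl (fun acc p => acc.setIfInBounds p.1 p.2) (Array.replicate N 0)

/-- `K5` has ten coordinates. [this work] -/
theorem mA5 : mA 5 = 10 := by decide


/-- Canonical relay list, observer not a relay, four relays: `[1, 2, 3, 4]`. [this work] -/
def As5B : List (Fin 5) := [1, 2, 3, 4]

/-- Canonical relay list, observer a relay, five relays: `[0, 1, 2, 3, 4]`. [this work] -/
def As5A : List (Fin 5) := [0, 1, 2, 3, 4]

/-- `As5B` enumerates `univ ∖ {0}`. [this work] -/
theorem toFinset_As5B : As5B.toFinset = (Finset.univ : Finset (Fin 5)).erase 0 := by decide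

/-- `As5A` enumerates `univ`. [this work] -/
theorem toFinset_As5A : As5A.toFinset = (Finset.univ : Finset (Fin 5)) := by decide

/-- `As5B` has no duplicates. [this work] -/
theorem nodup_As5B : As5B.Nodup := by decide

/-- `As5A` has no duplicates. [this work] -/
theorem nodup_As5A : As5A.Nodup := by decide

/-- **Reduction of a FAR layer on `Fin 5` with `A = univ ∖ {o}` or `A = univ` to the canonical open-cube statement at observer `0`.**
Given the open-cube statement for the canonical list `As` (`= σ A` for every `σ` with `σ o = 0`), `FARp w A o j` holds for all `w`. [this work] -/
theorem farp_fin5_of_canon (j : ℕ) (As : List (Fin 5)) (A : Finset (Fin 5)) (o : Fin 5)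
    (hmap : ∀ σ : Equiv.Perm (Fin 5), σ o = 0 → A.map σ.toEmbedding = As.toFinset)
    (hcan : ∀ w : Sym2 (Fin 5) → unitInterval, (∀ i < mA 5, 0 < wA w i ∧ wA w i < 1) →
      (2 * j : ℝ) ≤ (∑ x ∈ As.toFinset, (prodBernoulli w).real (openConn (0 : Fin 5) x)) → ∀ t : ℝ,
      (∀ x ∈ As.toFinset, (prodBernoulli w).real (openConn (0 : Fin 5) x)ᶜ ≤ t) →
      (prodBernoulli w).real {ω : Set (Sym2 (Fin 5)) |
        (As.toFinset.filter fun x => ω ∈ openConn (0 : Fin 5) x).card ≤ j} ≤ t)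
    (w : Sym2 (Fin 5) → unitInterval) : FARp w A o j := by
  refine FARp.of_generic A o j (fun w' hg => ?_) w
  refine FARp.of_relabel (Equiv.swap o 0) w' A o j ?_
  rw [hmap _ (Equiv.swap_apply_left o 0), Equiv.swap_apply_left]
  intro hEN t hcut
  exact hcan (relabelW _ w') (open_of_generic _ (generic_relabelW _ w' hg)) (le_of_lt hEN) t hcut

end Summit.CriticalPhenomena.PercolationContinuityZ3.Theorems.TwoCopy
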